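import Summits.CriticalPhenomena.CardyFormulaZ2.Theses.CardyBondTriangular
import Summits.CriticalPhenomena.CardyFormulaZ2.Theorems.CardyBondTriangularBondTriangularCardyDomainsGeometry
import Summits.CriticalPhenomena.CardyFormulaZ2.Theorems.CardyBondTriangularBondTriangularCardyWeakBoundary
import Summits.CriticalPhenomena.CardyFormulaZ2.Theorems.CardyBondTriangularBondTriangularCardySandwichLower
import Summits.CriticalPhenomena.CardyFormulaZ2.Theorems.CardyBondTriangularBondTriangularCardyBlueOfYellow
import HarnessLib

/-!
# Route CardyBondTriangular · crux `BondTriangularCardy` (stmt-CriticalPhenomena-4664), line `birth`: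
# stub `stub_discreteDomains` — the reduction to its parts (work file of the stub worker)

This is the stub worker's WORK FILE for `theorem stub_discreteDomains : Sig.stub_discreteDomains`
(reshape v3 of the line lead, 2026-08-17). It contains, verbatim from the lead's `work/Sig.lean`,
the definitions `Sig.discreteDomains` and `Sig.stub_discreteDomains`, the exact Lean signatures
of the three OPEN parts (`PartSig.yellowArm`, `PartSig.corner`, `PartSig.sandwichUpper`, each a
closed `Prop`), and the kernel-checked reduction
`discreteDomains_of_parts : PartSig.yellowArm → PartSig.corner → PartSig.sandwichUpper → Sig.stub_discreteDomains`
from the LANDED parts (all `--supports stmt-CriticalPhenomena-4664`, namespace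
`Summit.CriticalPhenomena.CardyFormulaZ2.Theorems.BondTriangularCardyLine`):

* (D1) `discreteDomains_geometry` (`Theorems/CardyBondTriangularBondTriangularCardyDomainsGeometry.lean`):
  the model-free geometry of Bollobás–Riordan's Lemma 14 — two discrete approximations `G∓`
  (`IsDiscreteApprox`) which are eventually longer–thinner / shorter–fatter at every `(t, ρ)`;
* (B1) `weakBoundaryValues_of_armBound` (`…WeakBoundary.lean`): the weak boundary values
  `fⁱ_δ(z_δ) → 0` on the open arc `Aᵢ` for ANY hexagon model with a yellow one-arm bound and ANY
  discrete approximation;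
* (D2)+(D3), lower half: `sandwichLower_of_armBound` (`…SandwichLower.lean`, with
  `…CrudeRun.lean`: `crude_of_walk`, `…CrudeLower.lean`: `crude_or_cornerArm_of_yellowCrossing`):
  `f⁻¹_δ(z⁻_δ) - e(δ) ≤ P_{p_c}(crude crossing)`, `e → 0`, from the yellow arm bound;
* the blue one-arm bound from the yellow one (`clBlueAnnulus_small_of_yellow`, landed by the
  stub worker of `stub_equicontinuity`; self-duality `isSelfDual_triBondCritical`).

The three open parts: the yellow one-arm bound for `triBondCritical` from the box-crossing
property (`PartSig.yellowArm`, literally the line's registered stub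
`clYellowAnnulus_small_of_boxCrossing`); the corner normalisation `f²_δ → 1` at `R.pt 1`
(`PartSig.corner`) and the upper half of the sandwich `P_{p_c}(crude) ≤ f⁺¹_δ(z⁺_δ) + e`
(`PartSig.sandwichUpper`) — both need the CHAYES–LEI DUALITY LEMMA (Lemma 5 of Bollobás–Riordan
for yellow/blue paths of hexagons with half-edge connectivity and yellow/blue boundary half-edges
at the stretch darts; not in the tree), besides a crosscut argument, the model-free blocking
theorem `separates_of_isChordless` and the two arm bounds.

References: B. Bollobás, O. Riordan, *Percolation*, CUP 2006, Ch. 7 (Lemma 14 p. 184, (19),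
Claim 20 p. 192, pp. 200–203) [BollobasRiordan2006]; L. Chayes, H. K. Lei, Rev. Math. Phys. 19
(2007) §2 [ChayesLei2007]; G. Grimmett, I. Manolescu, Ann. Probab. 41 (2013) §1.3
[GrimmettManolescuAOP2013].
-/

noncomputable section

namespace Summit.CriticalPhenomena.CardyFormulaZ2.Theorems.BondTriangularCardyLine

open Set Filter Topology Metric

/-! ### The registered signature (verbatim from the lead's `work/Sig.lean`, reshape v3) -/

/-- Unconditional core of Stub 4 (`Sig.discreteDomains`; the registered signature `Sig.stub_discreteDomains` is this from RSW): Lemma 14 with the boundary estimates and the sandwich, for critical bond-𝕋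
(Bollobás–Riordan 2006, Lemma 14 p. 184 with (19), proof of Claim 23 pp. 200–201, (40) p. 201,
p. 203): for a conformal rectangle with an ANTICLOCKWISE Carleson datum there are inner and outer
discrete approximations `G⁻`, `G⁺` (`IsDiscreteApprox`; the geometric construction of
`tri_exists_discreteApprox_proof` is model-free) such that the Chayes–Lei separating probabilities
of critical bond-𝕋 on `(G∓ δ).dropLast` have the boundary values of pp. 200–201 on the three open
arcs, and (reshape v3: the boundary values in their WEAK form `fⁱ → 0` on the open arc `Aᵢ` plus the corner normalisation `f² → 1` at `R.pt 1`; the sum-to-one clause of pp. 200–201 is supplied by the analysis stub `stub_weakBoundaryUpgrade`), and triangles `z∓_δ` of `G∓_δ` with centres in `Ω` tending to `d' = R.pt 3` sandwich the crude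
bond-𝕋 crossing probability of `Ω` at `embDomainCrossing`-mesh `δ/√3` (BR-mesh `δ`: the CL hexagon
centres = up-triangle centroids of the route's embedding sit on `δ𝕋`):
`f⁻¹_δ(z⁻_δ) - e(δ) ≤ P_𝕋(δ/√3) ≤ f⁺¹_δ(z⁺_δ) + e(δ)`, `e → 0`. Why plausibly true / where it may
fail: (19) is monotonicity for longer–thinner / shorter–fatter domains plus corner arm bounds
(`TriCrossingSandwichMarked` pattern) and the CL dictionary `openGraph_reachable_iff_clYellowGraph`;
(40) and `fⁱ → 0` are one-arm bounds; but `f^{i+1} + f^{i+2} → 1` needs, besides exact duality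
(BR Lemma 5), `P(blue 4-touch) = P(yellow 4-touch) + o(1)` in `G_δ`, which for bond-𝕋 is NOT a
colour symmetry: it rests on the self-duality of `triBondCritical` (colour reversal ∘ point
reflection, `isSelfDual_triBondCritical`; equivalently star–triangle at `2 sin(π/18)`) plus an
`O(δ)`-shift insensitivity of crossing probabilities of the CONSTRUCTED domains — hence the
existential (not `∀ G`) form. (ref: BollobasRiordan2006, Ch. 7 Lemma 14 p. 184, (19), Claim 20 p. 192, pp. 200–203; ChayesLei2006, Prop. 2.1; Wierman1981) -/
def Sig.discreteDomains : Prop :=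
    ∀ (R : Literature.Probability.RandomPlanarGeometry.ConformalRectangle) (a b c d : ℂ)
      (ψ : Literature.Probability.RandomPlanarGeometry.ConformalEquiv R.carrier (Literature.Probability.Percolation.openTriangle a b c)),
      Literature.Probability.Percolation.IsEquilateral a b c → d ∈ openSegment ℝ c a →
      Literature.Probability.Percolation.IsCarlesonMap R a b c d ψ →
      Literature.Probability.Percolation.triangleTurn a b c = Literature.Probability.Percolation.triOmega →
      ∃ Gm Gp : ℝ → Literature.Probability.Percolation.TriMarkedDomain 4, Literature.Probability.Percolation.IsDiscreteApprox R Gm ∧ Literature.Probability.Percolation.IsDiscreteApprox R Gp ∧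
        (∀ (i : Fin 3), ∀ z ∈ (Literature.Probability.RandomPlanarGeometry.MarkedDomain.forgetLast R).boundary ''
            Ioo ((Literature.Probability.RandomPlanarGeometry.MarkedDomain.forgetLast R).mark i)
              ((Literature.Probability.RandomPlanarGeometry.MarkedDomain.forgetLast R).nextMark i),
          ∃ zs : ℝ → Literature.Probability.LatticeModels.HexVertex,
            (∀ᶠ δ in 𝓝[>] (0 : ℝ), zs δ ∈ (Gm δ).faces ∧ (δ : ℂ) * Literature.Probability.LatticeModels.hexCenter (zs δ) ∈ R.carrier) ∧
              Tendsto (fun δ : ℝ => (δ : ℂ) * Literature.Probability.LatticeModels.hexCenter (zs δ)) (𝓝[>] 0) (𝓝 z) ∧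
                Tendsto (fun δ => (Gm δ).dropLast.clSepProb Literature.Probability.Percolation.ChayesLeiHexPercolation.triBondCritical i (zs δ))
                  (𝓝[>] 0) (𝓝 0)) ∧
        (∃ zs : ℝ → Literature.Probability.LatticeModels.HexVertex,
            (∀ᶠ δ in 𝓝[>] (0 : ℝ), zs δ ∈ (Gm δ).faces ∧ (δ : ℂ) * Literature.Probability.LatticeModels.hexCenter (zs δ) ∈ R.carrier) ∧
              Tendsto (fun δ : ℝ => (δ : ℂ) * Literature.Probability.LatticeModels.hexCenter (zs δ)) (𝓝[>] 0) (𝓝 (R.pt 1)) ∧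
                Tendsto (fun δ => (Gm δ).dropLast.clSepProb Literature.Probability.Percolation.ChayesLeiHexPercolation.triBondCritical 2 (zs δ))
                  (𝓝[>] 0) (𝓝 1)) ∧
        (∀ (i : Fin 3), ∀ z ∈ (Literature.Probability.RandomPlanarGeometry.MarkedDomain.forgetLast R).boundary ''
            Ioo ((Literature.Probability.RandomPlanarGeometry.MarkedDomain.forgetLast R).mark i)
              ((Literature.Probability.RandomPlanarGeometry.MarkedDomain.forgetLast R).nextMark i),
          ∃ zs : ℝ → Literature.Probability.LatticeModels.HexVertex,
            (∀ᶠ δ in 𝓝[>] (0 : ℝ), zs δ ∈ (Gp δ).faces ∧ (δ : ℂ) * Literature.Probability.LatticeModels.hexCenter (zs δ) ∈ R.carrier) ∧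
              Tendsto (fun δ : ℝ => (δ : ℂ) * Literature.Probability.LatticeModels.hexCenter (zs δ)) (𝓝[>] 0) (𝓝 z) ∧
                Tendsto (fun δ => (Gp δ).dropLast.clSepProb Literature.Probability.Percolation.ChayesLeiHexPercolation.triBondCritical i (zs δ))
                  (𝓝[>] 0) (𝓝 0)) ∧
        (∃ zs : ℝ → Literature.Probability.LatticeModels.HexVertex,
            (∀ᶠ δ in 𝓝[>] (0 : ℝ), zs δ ∈ (Gp δ).faces ∧ (δ : ℂ) * Literature.Probability.LatticeModels.hexCenter (zs δ) ∈ R.carrier) ∧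
              Tendsto (fun δ : ℝ => (δ : ℂ) * Literature.Probability.LatticeModels.hexCenter (zs δ)) (𝓝[>] 0) (𝓝 (R.pt 1)) ∧
                Tendsto (fun δ => (Gp δ).dropLast.clSepProb Literature.Probability.Percolation.ChayesLeiHexPercolation.triBondCritical 2 (zs δ))
                  (𝓝[>] 0) (𝓝 1)) ∧
        ∃ (zm zp : ℝ → Literature.Probability.LatticeModels.HexVertex) (e : ℝ → ℝ),
          (∀ᶠ δ : ℝ in 𝓝[>] 0, zm δ ∈ (Gm δ).faces ∧ (δ : ℂ) * Literature.Probability.LatticeModels.hexCenter (zm δ) ∈ R.carrier) ∧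
          (∀ᶠ δ : ℝ in 𝓝[>] 0, zp δ ∈ (Gp δ).faces ∧ (δ : ℂ) * Literature.Probability.LatticeModels.hexCenter (zp δ) ∈ R.carrier) ∧
          Tendsto (fun δ : ℝ => (δ : ℂ) * Literature.Probability.LatticeModels.hexCenter (zm δ)) (𝓝[>] 0) (𝓝 (R.pt 3)) ∧
          Tendsto (fun δ : ℝ => (δ : ℂ) * Literature.Probability.LatticeModels.hexCenter (zp δ)) (𝓝[>] 0) (𝓝 (R.pt 3)) ∧
          Tendsto e (𝓝[>] 0) (𝓝 0) ∧
          ∀ᶠ δ : ℝ in 𝓝[>] 0,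
            (Gm δ).dropLast.clSepProb Literature.Probability.Percolation.ChayesLeiHexPercolation.triBondCritical 1 (zm δ) - e δ ≤
              (Literature.Probability.Percolation.bondPercolation Literature.Probability.LatticeModels.triGraph (Literature.Probability.LatticeModels.criticalWeightI (Real.pi / 6))).real (Literature.Probability.Percolation.embDomainCrossing (fun x : Literature.Probability.LatticeModels.Site 2 ↦ (Real.sqrt 3 : ℂ) * (Literature.Probability.LatticeModels.triEmbed x - (1 + Literature.Probability.LatticeModels.triZeta) / 3)) R.carrier (δ / Real.sqrt 3) (R.arc 0) (R.arc 2)) ∧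
            (Literature.Probability.Percolation.bondPercolation Literature.Probability.LatticeModels.triGraph (Literature.Probability.LatticeModels.criticalWeightI (Real.pi / 6))).real (Literature.Probability.Percolation.embDomainCrossing (fun x : Literature.Probability.LatticeModels.Site 2 ↦ (Real.sqrt 3 : ℂ) * (Literature.Probability.LatticeModels.triEmbed x - (1 + Literature.Probability.LatticeModels.triZeta) / 3)) R.carrier (δ / Real.sqrt 3) (R.arc 0) (R.arc 2)) ≤
              (Gp δ).dropLast.clSepProb Literature.Probability.Percolation.ChayesLeiHexPercolation.triBondCritical 1 (zp δ) + e δ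

/-- Signature of `stub_discreteDomains` (reshape v2): Lemma 14 + boundary values + sandwich for critical bond-𝕋,
`Sig.discreteDomains`, from the box-crossing property (route item `BondTriangularBoxCrossing`, BY NAME). (ref: BollobasRiordan2006, Ch. 7 Lemma 14 p. 184; GrimmettManolescuAOP2013, §1.3 main theorem (b)) -/
def Sig.stub_discreteDomains : Prop :=
    Summit.CriticalPhenomena.CardyFormulaZ2.Theses.CardyBondTriangular.BondTriangularBoxCrossing → Sig.discreteDomains

/-! ### The parts of the stub (exact Lean signatures) -/

/-- **Part: the yellow one-arm bound for critical bond-`𝕋` from the box-crossing property.** For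
every `ε > 0` there are `ρ, C > 0` such that, at every mesh `δ` with `C δ ≤ r₁ ≤ ρ r₂`, a yellow
path of the Chayes–Lei representation of critical bond-`𝕋` from a hexagon within `r₁` of a point
`z` to a hexagon farther than `r₂` from `z` has probability `≤ ε` (Bollobás–Riordan's Lemma 4 /
one-arm RSW decay; the format of the helper `equicontinuity_of_arms_of_annulusBounds` of the stub
`stub_equicontinuity`). OPEN (from RSW: route item `BondTriangularBoxCrossing`). -/
def PartSig.yellowArm : Prop :=
  Summit.CriticalPhenomena.CardyFormulaZ2.Theses.CardyBondTriangular.BondTriangularBoxCrossing →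
    ∀ ε > (0 : ℝ), ∃ ρ > (0 : ℝ), ∃ C > (0 : ℝ), ∀ (δ : ℝ) (z : ℂ) (r₁ r₂ : ℝ), 0 < δ → C * δ ≤ r₁ → r₁ ≤ ρ * r₂ →
      (Literature.Probability.Percolation.clHexPercolation Literature.Probability.Percolation.ChayesLeiHexPercolation.triBondCritical).real
        {σ | ∃ x y : Literature.Probability.LatticeModels.Site 2, (Literature.Probability.Percolation.clYellowGraph σ).Reachable x y ∧
          ‖Literature.Probability.LatticeModels.triMeshPoint δ x - z‖ < r₁ ∧ r₂ < ‖Literature.Probability.LatticeModels.triMeshPoint δ y - z‖} ≤ ε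

/-- **Part (B2): the corner normalisation `f²_δ → 1` at `R.pt 1`.** For any hexagon model `M`
with the yellow AND the blue one-arm bounds, and any discrete approximation `G_δ` of `R`, there
are triangles `z_δ` of `G_δ` with centres in `Ω` tending to the marked point `R.pt 1` (between
`A₀` and `A₁`) at which `f²_δ(z_δ) = P(E²_δ(z_δ)) → 1`: yellow paths from `A₀` to `A₁` cutting the
corner at `R.pt 1` exist at all scales w.h.p.; their failure forces, by the Chayes–Lei duality
lemma (Lemma 5 of Bollobás–Riordan for yellow/blue paths with half-edge connectivity) in a
re-marked domain, a blue arm across an annulus about `R.pt 1`, and a separating such path exists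
off a local bad event (a yellow arm near `R.pt 1`) by the blocking theorem
`separates_of_isChordless`. OPEN. -/
def PartSig.corner : Prop :=
  ∀ (M : Literature.Probability.Percolation.ChayesLeiHexPercolation),
    (∀ ε > (0 : ℝ), ∃ ρ > (0 : ℝ), ∃ C > (0 : ℝ), ∀ (δ : ℝ) (z : ℂ) (r₁ r₂ : ℝ), 0 < δ → C * δ ≤ r₁ → r₁ ≤ ρ * r₂ →
      (Literature.Probability.Percolation.clHexPercolation M).real {σ | ∃ x y : Literature.Probability.LatticeModels.Site 2,
        (Literature.Probability.Percolation.clYellowGraph σ).Reachable x y ∧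
          ‖Literature.Probability.LatticeModels.triMeshPoint δ x - z‖ < r₁ ∧ r₂ < ‖Literature.Probability.LatticeModels.triMeshPoint δ y - z‖} ≤ ε) →
    (∀ ε > (0 : ℝ), ∃ ρ > (0 : ℝ), ∃ C > (0 : ℝ), ∀ (δ : ℝ) (z : ℂ) (r₁ r₂ : ℝ), 0 < δ → C * δ ≤ r₁ → r₁ ≤ ρ * r₂ →
      (Literature.Probability.Percolation.clHexPercolation M).real {σ | ∃ x y : Literature.Probability.LatticeModels.Site 2,
        (Literature.Probability.Percolation.clBlueGraph σ).Reachable x y ∧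
          ‖Literature.Probability.LatticeModels.triMeshPoint δ x - z‖ < r₁ ∧ r₂ < ‖Literature.Probability.LatticeModels.triMeshPoint δ y - z‖} ≤ ε) →
    ∀ (R : Literature.Probability.RandomPlanarGeometry.ConformalRectangle) (G : ℝ → Literature.Probability.Percolation.TriMarkedDomain 4),
      Literature.Probability.Percolation.IsDiscreteApprox R G →
      ∃ zs : ℝ → Literature.Probability.LatticeModels.HexVertex,
        (∀ᶠ δ in nhdsWithin (0 : ℝ) (Set.Ioi 0), zs δ ∈ (G δ).faces ∧ (δ : ℂ) * Literature.Probability.LatticeModels.hexCenter (zs δ) ∈ R.carrier) ∧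
          Filter.Tendsto (fun δ : ℝ => (δ : ℂ) * Literature.Probability.LatticeModels.hexCenter (zs δ)) (nhdsWithin (0 : ℝ) (Set.Ioi 0)) (nhds (R.pt 1)) ∧
            Filter.Tendsto (fun δ => (G δ).dropLast.clSepProb M 2 (zs δ)) (nhdsWithin (0 : ℝ) (Set.Ioi 0)) (nhds 1)

/-- **Part (D2)+(D3), upper half: `P_{p_c}(crude crossing) ≤ f⁺¹_δ(z⁺_δ) + e(δ)`.** For critical
bond-`𝕋` in its Chayes–Lei representation with the yellow AND the blue one-arm bounds: if `G⁺_δ`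
is a discrete approximation of `R` which is eventually shorter–fatter at every `(t, ρ)`, there are
triangles `z⁺_δ` of `G⁺_δ` with centres in `Ω` tending to `R.pt 3` and `e(δ) → 0` with
`P_{p_c}(crude crossing of Ω at mesh δ/√3 from A₀ to A₂) ≤ f⁺¹_δ(z⁺_δ) + e(δ)` (Bollobás–Riordan's
(19), Claims 19–20 p. 192 with Lemma 5 p. 169, and (40) p. 201): an open crude crossing excludes
every blue crossing of `G⁺_δ` from `A₁` to `A₃` staying `ρ`-far from the corners (the centre polygon
of a blue hexagon path crosses only closed bonds — blue adjacency at the common up-corner closes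
the two bonds facing it, `clBlueGraph_clOfBond_adj_iff` — hence is disjoint from the open bond
path; crosscut theorem), so by the CHAYES–LEI DUALITY LEMMA (Lemma 5 for yellow/blue paths with
half-edge connectivity and yellow/blue boundary half-edges; not in the tree) `G⁺_δ` has a yellow
crossing from `A₀` to `A₂`, which separates `z⁺_δ` off a local bad event
(`separates_of_isChordless`, model-free). OPEN. -/
def PartSig.sandwichUpper : Prop :=
  (∀ ε > (0 : ℝ), ∃ ρ > (0 : ℝ), ∃ C > (0 : ℝ), ∀ (δ : ℝ) (z : ℂ) (r₁ r₂ : ℝ), 0 < δ → C * δ ≤ r₁ → r₁ ≤ ρ * r₂ →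
    (Literature.Probability.Percolation.clHexPercolation Literature.Probability.Percolation.ChayesLeiHexPercolation.triBondCritical).real
      {σ | ∃ x y : Literature.Probability.LatticeModels.Site 2, (Literature.Probability.Percolation.clYellowGraph σ).Reachable x y ∧
        ‖Literature.Probability.LatticeModels.triMeshPoint δ x - z‖ < r₁ ∧ r₂ < ‖Literature.Probability.LatticeModels.triMeshPoint δ y - z‖} ≤ ε) →
  (∀ ε > (0 : ℝ), ∃ ρ > (0 : ℝ), ∃ C > (0 : ℝ), ∀ (δ : ℝ) (z : ℂ) (r₁ r₂ : ℝ), 0 < δ → C * δ ≤ r₁ → r₁ ≤ ρ * r₂ →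
    (Literature.Probability.Percolation.clHexPercolation Literature.Probability.Percolation.ChayesLeiHexPercolation.triBondCritical).real
      {σ | ∃ x y : Literature.Probability.LatticeModels.Site 2, (Literature.Probability.Percolation.clBlueGraph σ).Reachable x y ∧
        ‖Literature.Probability.LatticeModels.triMeshPoint δ x - z‖ < r₁ ∧ r₂ < ‖Literature.Probability.LatticeModels.triMeshPoint δ y - z‖} ≤ ε) →
  ∀ (R : Literature.Probability.RandomPlanarGeometry.ConformalRectangle) (Gp : ℝ → Literature.Probability.Percolation.TriMarkedDomain 4),
    Literature.Probability.Percolation.IsDiscreteApprox R Gp →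
    (∀ ρ > (0 : ℝ), ∀ t > (0 : ℝ), ∀ᶠ δ : ℝ in nhdsWithin (0 : ℝ) (Set.Ioi 0), (Gp δ).IsShorterFatter R δ t ρ) →
    ∃ (zp : ℝ → Literature.Probability.LatticeModels.HexVertex) (e : ℝ → ℝ),
      (∀ᶠ δ : ℝ in nhdsWithin (0 : ℝ) (Set.Ioi 0), zp δ ∈ (Gp δ).faces ∧ (δ : ℂ) * Literature.Probability.LatticeModels.hexCenter (zp δ) ∈ R.carrier) ∧
      Filter.Tendsto (fun δ : ℝ => (δ : ℂ) * Literature.Probability.LatticeModels.hexCenter (zp δ)) (nhdsWithin (0 : ℝ) (Set.Ioi 0)) (nhds (R.pt 3)) ∧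
      Filter.Tendsto e (nhdsWithin (0 : ℝ) (Set.Ioi 0)) (nhds 0) ∧
      ∀ᶠ δ : ℝ in nhdsWithin (0 : ℝ) (Set.Ioi 0),
        (Literature.Probability.Percolation.bondPercolation Literature.Probability.LatticeModels.triGraph
            (Literature.Probability.LatticeModels.criticalWeightI (Real.pi / 6))).real
          (Literature.Probability.Percolation.embDomainCrossing
            (fun x : Literature.Probability.LatticeModels.Site 2 ↦ (Real.sqrt 3 : ℂ) * (Literature.Probability.LatticeModels.triEmbed x - (1 + Literature.Probability.LatticeModels.triZeta) / 3))
            R.carrier (δ / Real.sqrt 3) (R.arc 0) (R.arc 2)) ≤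
          (Gp δ).dropLast.clSepProb Literature.Probability.Percolation.ChayesLeiHexPercolation.triBondCritical 1 (zp δ) + e δ

/-! ### The reduction -/

/-- **The reduction of the stub to its three open parts (kernel-checked).** Given the yellow
one-arm bound from RSW (`PartSig.yellowArm`, the registered stub `clYellowAnnulus_small_of_boxCrossing`
of the line), the corner normalisation (B2) and the upper half of the sandwich, the registered
signature `Sig.stub_discreteDomains` follows from the LANDED parts: the geometry (D1)
`discreteDomains_geometry`, the weak boundary values (B1) `weakBoundaryValues_of_armBound`, the
lower half of the sandwich `sandwichLower_of_armBound`, and the blue one-arm bound from the yellow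
one by self-duality, `clBlueAnnulus_small_of_yellow` with `isSelfDual_triBondCritical`; the two
halves of the sandwich are combined with `e = |e⁻| + |e⁺|`. -/
theorem discreteDomains_of_parts : PartSig.yellowArm → PartSig.corner → PartSig.sandwichUpper → Sig.stub_discreteDomains := by
  intro hY hcorner hup hrsw R a b c d ψ habc hd hψ hturn
  obtain ⟨Gm, Gp, hGm, hGp, hLT, hSF⟩ := discreteDomains_geometry R a b c d ψ habc hd hψ hturn
  have hy := hY hrsw
  have hb := clBlueAnnulus_small_of_yellow _
    Literature.Probability.Percolation.ChayesLeiHexPercolation.isSelfDual_triBondCritical hy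
  obtain ⟨zm, em, hzm, hztm, hem, hsm⟩ := sandwichLower_of_armBound hy R Gm hGm hLT
  obtain ⟨zp, ep, hzp, hztp, hep, hsp⟩ := hup hy hb R Gp hGp hSF
  refine ⟨Gm, Gp, hGm, hGp,
    weakBoundaryValues_of_armBound _ hy R Gm hGm, hcorner _ hy hb R Gm hGm,
    weakBoundaryValues_of_armBound _ hy R Gp hGp, hcorner _ hy hb R Gp hGp,
    zm, zp, fun δ => |em δ| + |ep δ|, hzm, hzp, hztm, hztp, ?_, ?_⟩
  · have h := hem.abs.add hep.abs
    simpa using h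
  · filter_upwards [hsm, hsp] with δ hm hp
    constructor
    · linarith [le_abs_self (em δ), abs_nonneg (ep δ)]
    · linarith [le_abs_self (ep δ), abs_nonneg (em δ)]

end Summit.CriticalPhenomena.CardyFormulaZ2.Theorems.BondTriangularCardyLine

end
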